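import Summits.MatrixMultiplication.MatrixMultiplication.Theorems.SubgroupIdentityDesigns.Negative.TripleShift

/-!
# The cell-function law (negative lemma for the crux `SubgroupIdentityDesigns`,
# stmt-MatrixMultiplication-14079) — VALUE = THEOREM (all p, explicit certificate), NOT summit
# progress; the crux stays open.

The complete `U⁺`-invariant form of the triple rectangle law (`TripleCells`, `TripleShift`).
A CELL FUNCTION is `e : 𝔽_p → 𝔽_p → ℂ` with all row sums and all column sums zero
(`∑_α e α β = 0`, `∑_β e α β = 0`).  The level-1 functional
`λ_e (g) = ∑_{α,β} e α β · [g ∈ B(α, β)]` (`B(α,β) = {[[α,x],[0,β]]}`) annihilates the whole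
level-1 space: pushed through a Fourier expansion it meets a rank-`≤ 1` matrix `M` only through
`ψ(M₀₀ α + M₁₁ β) · p · [M₁₀ = 0]`, and `M₁₀ = 0`, `det M = 0` force `M₀₀ M₁₁ = 0`, so one of the
two zero-sum conditions kills the sum (`cellFn_bracket`).  Consequently
(`no_idTest_of_cellFn`): if every cell in the support of `e` consists of triple products
`a b c` (`a ∈ H₁`, `b ∈ H₂`, `c ∈ H₃`) and `e` is non-zero at the cell of some point
`h₀ = a₀ c₀ ∈ H₁H₃`, there is no level-1 identity design — pair `λ_e` with the shifted design of
`TripleShift`.  Rectangles are the cell functions `±1` on four points; the cell functions are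
exactly the cycle space of the bipartite graph of cells inside `H₁H₂H₃`, so this is the
"cell-cycle criterion" in full.  No TPP hypothesis is used.

Also `eq_one_of_tpp_udl`: the subgroup TPP read on the same diagonal data (UDL factorisation of an
element of the third member).  Census note (ORACLE §G14-11/12, kit jobs j111725, j111747,
j111820): at `p ≤ 11` (two `p`-members) and `p ≤ 7` (one `p`-member) the 4-cycles through the
identity cell already decide every subgroup-TPP triple above the floor, so the general cell
functions are insurance for larger `p`; data, not an all-`p` theorem.
-/

set_option linter.dupNamespace false

noncomputable section

open scoped BigOperators Classical
open Summit.MatrixMultiplication.MatrixMultiplication.Theorems.LieRankDesigns.Negative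
  (GLm Mat fourierFn)
open Summit.MatrixMultiplication.MatrixMultiplication.Theorems.LevelOneGL2Designs.Negative
  (levelSubmodule mem_levelSubmodule_iff fourierFn_mem_levelSubmodule levelSubmodule_bi_inv)
open Literature.Barriers.MatrixMultiplication (SubgroupTPP)

namespace Summit.MatrixMultiplication.MatrixMultiplication.Theorems.SubgroupIdentityDesigns.Negative

section CellFunction

variable {p : ℕ} [hp : Fact p.Prime]

/-- The bracket: a cell function pairs to zero with every rank-`≤ 1` frequency. -/
theorem cellFn_bracket (e : ZMod p → ZMod p → ℂ) (hrow : ∀ β, ∑ α, e α β = 0)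
    (hcol : ∀ α, ∑ β, e α β = 0) (M : Mat p 2) (hM : M.det = 0) :
    ∑ α, ∑ β, e α β * ∑ x : ZMod p, ZMod.stdAddChar (Matrix.trace (M * !![α, x; 0, β])) = 0 := by
  simp_rw [ucell_sum M]
  by_cases h10 : M 1 0 = 0
  · have hprod : M 0 0 * M 1 1 = 0 := by
      rw [Matrix.det_fin_two, h10, mul_zero, sub_zero] at hM; exact hM
    simp only [h10, if_true]
    rcases mul_eq_zero.1 hprod with h0 | h0
    · simp only [h0, zero_mul, zero_add]
      rw [Finset.sum_comm]
      refine Finset.sum_eq_zero fun β _ => ?_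
      rw [← Finset.sum_mul, hrow β, zero_mul]
    · simp only [h0, zero_mul, add_zero]
      refine Finset.sum_eq_zero fun α _ => ?_
      rw [← Finset.sum_mul, hcol α, zero_mul]
  · simp [h10]

/-- Push-forward of the cell functional `λ_e` through a level-1 function. -/
theorem cellFn_push (e : ZMod p → ZMod p → ℂ) (hz : ∀ α β, e α β ≠ 0 → α * β ≠ 0)
    (c : Mat p 2 → ℂ) :
    ∑ g : GLm p 2, (∑ α, ∑ β, e α β *
        ∑ x : ZMod p, if (g : Mat p 2) = !![α, x; 0, β] then (1 : ℂ) else 0) * fourierFn c g =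
      ∑ M : Mat p 2, c M * ∑ α, ∑ β, e α β *
        ∑ x : ZMod p, ZMod.stdAddChar (Matrix.trace (M * !![α, x; 0, β])) := by
  calc ∑ g : GLm p 2, (∑ α, ∑ β, e α β *
          ∑ x : ZMod p, if (g : Mat p 2) = !![α, x; 0, β] then (1 : ℂ) else 0) * fourierFn c g
      = ∑ g : GLm p 2, ∑ α, ∑ β, e α β *
          ((∑ x : ZMod p, if (g : Mat p 2) = !![α, x; 0, β] then (1 : ℂ) else 0) *
            fourierFn c g) := by
        refine Finset.sum_congr rfl fun g _ => ?_
        rw [Finset.sum_mul]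
        refine Finset.sum_congr rfl fun α _ => ?_
        rw [Finset.sum_mul]
        exact Finset.sum_congr rfl fun β _ => mul_assoc _ _ _
    _ = ∑ α, ∑ β, e α β * ∑ g : GLm p 2,
          (∑ x : ZMod p, if (g : Mat p 2) = !![α, x; 0, β] then (1 : ℂ) else 0) *
            fourierFn c g := by
        rw [Finset.sum_comm]
        refine Finset.sum_congr rfl fun α _ => ?_
        rw [Finset.sum_comm]
        exact Finset.sum_congr rfl fun β _ => (Finset.mul_sum _ _ _).symm
    _ = ∑ α, ∑ β, e α β * ∑ M : Mat p 2, c M *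
          ∑ x : ZMod p, ZMod.stdAddChar (Matrix.trace (M * !![α, x; 0, β])) := by
        refine Finset.sum_congr rfl fun α _ => Finset.sum_congr rfl fun β _ => ?_
        by_cases he : e α β = 0
        · rw [he, zero_mul, zero_mul]
        · rw [ucell_push α β (hz α β he) c]
    _ = ∑ M : Mat p 2, c M * ∑ α, ∑ β, e α β *
          ∑ x : ZMod p, ZMod.stdAddChar (Matrix.trace (M * !![α, x; 0, β])) := by
        simp only [Finset.mul_sum]
        refine (Finset.sum_congr rfl fun α _ => Finset.sum_comm).trans ?_
        rw [Finset.sum_comm]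
        exact Finset.sum_congr rfl fun M _ => Finset.sum_congr rfl fun α _ =>
          Finset.sum_congr rfl fun β _ => by ring

/-- **Cell-function law.**  A cell function `e` (zero row and column sums) whose support cells
consist of triple products of `(H₁, H₂, H₃)` and which is non-zero at the cell of a point
`a₀ c₀ ∈ H₁H₃` excludes every level-1 identity design.  No TPP hypothesis. -/
theorem no_idTest_of_cellFn {H₁ H₂ H₃ : Subgroup (GLm p 2)} (e : ZMod p → ZMod p → ℂ)
    (hrow : ∀ β, ∑ α, e α β = 0) (hcol : ∀ α, ∑ β, e α β = 0)
    (hcell : ∀ α β, e α β ≠ 0 → ∀ x : ZMod p,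
      ∃ a ∈ H₁, ∃ b ∈ H₂, ∃ c ∈ H₃, ((a * b * c : GLm p 2) : Mat p 2) = !![α, x; 0, β])
    {a₀ c₀ : GLm p 2} (ha₀ : a₀ ∈ H₁) (hc₀ : c₀ ∈ H₃) {α₀ β₀ x₀ : ZMod p}
    (h₀ : ((a₀ * c₀ : GLm p 2) : Mat p 2) = !![α₀, x₀; 0, β₀]) (he₀ : e α₀ β₀ ≠ 0) :
    ¬ ∃ f ∈ levelSubmodule p 2 1, f 1 = 1 ∧
        ∀ a ∈ H₁, ∀ b ∈ H₂, ∀ c ∈ H₃, a * b * c ≠ 1 → f (a * b * c) = 0 := by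
  intro hdes
  obtain ⟨f, hf, hf1, hf0⟩ := shifted_design hdes ha₀ hc₀
  set lam : GLm p 2 → ℂ := fun g => ∑ α, ∑ β, e α β *
      ∑ x : ZMod p, if (g : Mat p 2) = !![α, x; 0, β] then (1 : ℂ) else 0 with hlam
  have hz : ∀ α β, e α β ≠ 0 → α * β ≠ 0 := by
    intro α β he
    obtain ⟨a, -, b, -, c, -, habc⟩ := hcell α β he 0
    have hd := Matrix.GeneralLinearGroup.det_ne_zero (a * b * c)
    rw [habc, Matrix.det_fin_two_of] at hd
    simpa using hd
  have hann : ∑ g, lam g * f g = 0 := by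
    obtain ⟨c, hc, hfc⟩ := mem_levelSubmodule_iff.mp hf
    rw [show f = fourierFn c from funext hfc]
    simp only [hlam]
    rw [cellFn_push e hz c]
    refine Finset.sum_eq_zero fun M _ => ?_
    by_cases hM : M.det = 0
    · rw [cellFn_bracket e hrow hcol M hM, mul_zero]
    · rw [hc M (one_lt_rank_of_det_ne_zero M hM), zero_mul]
  have hzero : ∀ g : GLm p 2, g ≠ a₀ * c₀ → lam g * f g = 0 := by
    intro g hg
    by_cases hl : lam g = 0
    · rw [hl, zero_mul]
    · obtain ⟨α, β, x, he, hgx⟩ :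
          ∃ α β x : ZMod p, e α β ≠ 0 ∧ (g : Mat p 2) = !![α, x; 0, β] := by
        by_contra hne
        push Not at hne
        apply hl
        refine Finset.sum_eq_zero fun α _ => Finset.sum_eq_zero fun β _ => ?_
        by_cases he : e α β = 0
        · rw [he, zero_mul]
        · rw [Finset.sum_eq_zero fun x _ => if_neg (hne α β x he), mul_zero]
      obtain ⟨a, ha, b, hb, c, hc, habc⟩ := hcell α β he x
      have hg' : g = a * b * c := Units.ext (hgx.trans habc.symm)
      rw [hg', hf0 a ha b hb c hc (hg' ▸ hg), mul_zero]
  have hval : lam (a₀ * c₀) = e α₀ β₀ := by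
    simp only [hlam, h₀, ucell_eq_iff]
    rw [Finset.sum_eq_single α₀]
    · rw [Finset.sum_eq_single β₀]
      · simp
      · intro β _ hβ
        rw [Finset.sum_eq_zero fun x _ => if_neg fun h => hβ h.2.2.symm, mul_zero]
      · exact fun h => absurd (Finset.mem_univ _) h
    · intro α _ hα
      exact Finset.sum_eq_zero fun β _ => by
        rw [Finset.sum_eq_zero fun x _ => if_neg fun h => hα h.1.symm, mul_zero]
    · exact fun h => absurd (Finset.mem_univ _) h
  have h := hann
  rw [Finset.sum_eq_single (a₀ * c₀) (fun g _ hg => hzero g hg)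
    (fun h' => absurd (Finset.mem_univ _) h'), hf1, mul_one, hval] at h
  exact he₀ h

/-- The cell-function law at the identity (`a₀ = c₀ = 1`): a cell function supported on cells of
triple products with `e 1 1 ≠ 0` excludes every level-1 identity design. -/
theorem no_idTest_of_cellFn_one {H₁ H₂ H₃ : Subgroup (GLm p 2)} (e : ZMod p → ZMod p → ℂ)
    (hrow : ∀ β, ∑ α, e α β = 0) (hcol : ∀ α, ∑ β, e α β = 0)
    (hcell : ∀ α β, e α β ≠ 0 → ∀ x : ZMod p,
      ∃ a ∈ H₁, ∃ b ∈ H₂, ∃ c ∈ H₃, ((a * b * c : GLm p 2) : Mat p 2) = !![α, x; 0, β])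
    (he : e 1 1 ≠ 0) :
    ¬ ∃ f ∈ levelSubmodule p 2 1, f 1 = 1 ∧
        ∀ a ∈ H₁, ∀ b ∈ H₂, ∀ c ∈ H₃, a * b * c ≠ 1 → f (a * b * c) = 0 := by
  have h₀ : (((1 : GLm p 2) * 1 : GLm p 2) : Mat p 2) = !![1, 0; 0, 1] := by
    rw [mul_one]; exact coe_one_eq_ucell
  exact no_idTest_of_cellFn e hrow hcol hcell H₁.one_mem H₃.one_mem h₀ he

/-- The cell-function law in the vocabulary of the crux `SubgroupIdentityDesigns`. -/
theorem no_levelOne_design_of_cellFn {H₁ H₂ H₃ : Subgroup (GLm p 2)}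
    (e : ZMod p → ZMod p → ℂ) (hrow : ∀ β, ∑ α, e α β = 0) (hcol : ∀ α, ∑ β, e α β = 0)
    (hcell : ∀ α β, e α β ≠ 0 → ∀ x : ZMod p,
      ∃ a ∈ H₁, ∃ b ∈ H₂, ∃ c ∈ H₃, ((a * b * c : GLm p 2) : Mat p 2) = !![α, x; 0, β])
    {a₀ c₀ : GLm p 2} (ha₀ : a₀ ∈ H₁) (hc₀ : c₀ ∈ H₃) {α₀ β₀ x₀ : ZMod p}
    (h₀ : ((a₀ * c₀ : GLm p 2) : Mat p 2) = !![α₀, x₀; 0, β₀]) (he₀ : e α₀ β₀ ≠ 0) :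
    ¬ ∃ c : Mat p 2 → ℂ, (∀ M, 1 < M.rank → c M = 0) ∧
        (∑ M, c M * ZMod.stdAddChar (Matrix.trace (M * ((1 : GLm p 2) : Mat p 2)))) = 1 ∧
        ∀ a ∈ H₁, ∀ b ∈ H₂, ∀ g ∈ H₃, a * b * g ≠ 1 →
          (∑ M, c M *
            ZMod.stdAddChar (Matrix.trace (M * ((a * b * g : GLm p 2) : Mat p 2)))) = 0 := by
  rintro ⟨c, hc, hc1, hc0⟩
  refine no_idTest_of_cellFn e hrow hcol hcell ha₀ hc₀ h₀ he₀
    ⟨fourierFn c, fourierFn_mem_levelSubmodule hc, hc1, fun a ha b hb g hg hne => ?_⟩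
  exact hc0 a ha b hb g hg hne

/-- **TPP in cell vocabulary.**  With `U⁺ ≤ H₁` and `U⁻ ≤ H₂`, an element `s ∈ H₃` with
`s₁₁ ≠ 0` whose UDL-diagonal `diag(det s / s₁₁, s₁₁)` is a product `a b` (`a ∈ H₁`, `b ∈ H₂`) is
trivial: `s = (u a)(b v)` with `u ∈ U⁺`, `v ∈ U⁻`.  (Dual to `cell_of_triple`: the subgroup TPP of a
frame triple reads `Σ⁻(H₃ ∖ 1) ∩ D̃ = ∅` on the diagonal data.) -/
theorem eq_one_of_tpp_udl {H₁ H₂ H₃ : Subgroup (GLm p 2)} (htpp : SubgroupTPP H₁ H₂ H₃)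
    (hU : ∀ u : GLm p 2, (u : Mat p 2) 1 0 = 0 → (u : Mat p 2) 0 0 = 1 → (u : Mat p 2) 1 1 = 1 →
      u ∈ H₁)
    (hV : ∀ v : GLm p 2, (v : Mat p 2) 0 1 = 0 → (v : Mat p 2) 0 0 = 1 → (v : Mat p 2) 1 1 = 1 →
      v ∈ H₂)
    {s : GLm p 2} (hs : s ∈ H₃) (hs1 : (s : Mat p 2) 1 1 ≠ 0)
    (hd : ∃ a ∈ H₁, ∃ b ∈ H₂, ((a * b : GLm p 2) : Mat p 2) =
      !![Matrix.det (s : Mat p 2) / (s : Mat p 2) 1 1, 0; 0, (s : Mat p 2) 1 1]) : s = 1 := by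
  obtain ⟨a, ha, b, hb, hab⟩ := hd
  obtain ⟨u, hu⟩ : ∃ u : GLm p 2,
      (u : Mat p 2) = !![1, (s : Mat p 2) 0 1 / (s : Mat p 2) 1 1; 0, 1] :=
    ⟨Matrix.GeneralLinearGroup.mkOfDetNeZero _ (by rw [Matrix.det_fin_two_of]; simp), rfl⟩
  obtain ⟨v, hv⟩ : ∃ v : GLm p 2,
      (v : Mat p 2) = !![1, 0; (s : Mat p 2) 1 0 / (s : Mat p 2) 1 1, 1] :=
    ⟨Matrix.GeneralLinearGroup.mkOfDetNeZero _ (by rw [Matrix.det_fin_two_of]; simp), rfl⟩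
  have hdet : Matrix.det (s : Mat p 2) =
      (s : Mat p 2) 0 0 * (s : Mat p 2) 1 1 - (s : Mat p 2) 0 1 * (s : Mat p 2) 1 0 :=
    Matrix.det_fin_two _
  have hs' : s = (u * a) * (b * v) := by
    apply Units.ext
    have hm : ((u * a * (b * v) : GLm p 2) : Mat p 2) =
        (u : Mat p 2) * ((a * b : GLm p 2) : Mat p 2) * (v : Mat p 2) := by
      simp only [Units.val_mul, mul_assoc]
    rw [hm, hu, hab, hv]
    ext i j
    fin_cases i <;> fin_cases j <;> simp [Matrix.mul_apply, Fin.sum_univ_two, hdet]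
    all_goals field_simp
    ring
  have hua : u * a ∈ H₁ := H₁.mul_mem (hU u (by simp [hu]) (by simp [hu]) (by simp [hu])) ha
  have hbv : b * v ∈ H₂ := H₂.mul_mem hb (hV v (by simp [hv]) (by simp [hv]) (by simp [hv]))
  have h1 := htpp (u * a) hua (b * v) hbv s⁻¹ (H₃.inv_mem hs) (by rw [← hs', mul_inv_cancel])
  exact inv_eq_one.mp h1.2.2

end CellFunction

end Summit.MatrixMultiplication.MatrixMultiplication.Theorems.SubgroupIdentityDesigns.Negative

end
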